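import Summits.QuantumFields.YangMills.Theorems.SmallFieldWideningLargeFieldMassRefinementTailOfFirstExit

/-!
# Route `FirstExitWindow` (QuantumFields / YangMills; rung-R3 leaf `T3YM3TorusStatement.YM3TorusSU2`) — THE GLUE
# `HistoryTailOfFirstExit` (support item stmt-QuantumFields-26245), PROVED

WHAT THIS IS NOT: not a proof of the route's crux `FirstExitWindowTailL` (stmt-QuantumFields-26243) nor of its support `OneStepWindowL`
(stmt-QuantumFields-26244, both hypotheses here), nor of the parent route's residual cruxes; no large-field estimate is proved, nothing bears
on the Yang–Mills mass gap, and the rung R3 (`YM3TorusSU2`, a RECORD rung, not the Clay statement) stays open.  It is the route's provable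
bookkeeping: `OneStepWindowL → FirstExitWindowTailL →` the body of the parent crux `UnitScaleTilt.HistoryTailL` (stmt-QuantumFields-19936) —
`T3UnitScaleTilt.HistoryTailAt F γ b₀ p₀ m` for every volume-free top fraction `1/m`, `m ≥ 1`, at the profile `b₀ = max b₁ 1`, `p₀ = max p₁ 3`
above any floor `(b₁, p₁)`, with `γ₁ = min γ_W γ_F`.

THE ARGUMENT (all pieces landed).  A configuration outside Bałaban's UV-small-history event `histGood K n` has a LEAST bad height `j*`
(`HistoryTailOfTwoSided.compl_histGood_subset_iUnion_finestBad`, [Balaban1985UV3] (7) p.257 organised by the first large scale); `j* = 0` is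
the bare large-field event, paid by the landed `T3BareTailProfile.bareTailAt` (reflection positivity + chessboard); at `j* ≥ 1` the window
(applied to the small level `j*−1`) puts `Ū^{j*}` inside the `b₂`-window and the offending plaquette `p` puts the configuration in the
first-exit event of `(j*, p)`, so the finest-bad-level masses have the geometric profile `A'·2^{−(K−j)}`
(`LargeFieldMassRefinementTailOfFirstExit.exists_finestBad_profile`: union over the `≤ 9·(2L^{m+K−j})³` plaquettes and the tree's per-height
arithmetic `T3AveragedTailProfile.perHeight_bound`); the reduction `HistoryTailOfTwoSided.historyTailAt_of_bare_finestBad` (free top fraction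
`⌊K/m⌋`, `w_K = 𝟙[K < 2m] + q₀ K + q₀ (K+1) + 2A'·2^{−⌊K/m⌋}`, summable by `T3HistoryTailReduction.summable_comp_div`) gives `HistoryTailAt`.

References: T. Bałaban, CMP 102 (1985) 255–275 [Balaban1985UV3] ((7) p.257, (71) p.273); J. Fröhlich, R. Israel, E. Lieb, B. Simon,
CMP 62 (1978) 1–34 [FrohlichIsraelLiebSimon1978] (chessboard estimate behind the bare term).
-/

noncomputable section

open MeasureTheory Filter Topology
open Literature.MathematicalPhysics.QuantumFieldTheory.Balaban1983to89
open Literature.MathematicalPhysics.QuantumFieldTheory.Balaban1983to89.Missing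
open Literature.MathematicalPhysics.QuantumFieldTheory.Balaban1983to89.T4Continuum
open Literature.MathematicalPhysics.QuantumFieldTheory.Balaban1983to89.T3ContinuumYM3Torus
open Literature.MathematicalPhysics.QuantumFieldTheory.Balaban1983to89.T3UnitScaleTilt
open Literature.MathematicalPhysics.QuantumFieldTheory.Balaban1983to89.T3UnitLawDensityEML (ℰp measurableE_ℰp)
open Literature.MathematicalPhysics.QuantumFieldTheory.Balaban1983to89.T3CruxEstimates
open Literature.MathematicalPhysics.QuantumFieldTheory.Balaban1983to89.T3BareTailProfile
open Literature.MathematicalPhysics.QuantumFieldTheory.Balaban1983to89.T3AveragedTailProfile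
open Summit.QuantumFields.YangMills.Theorems.HistoryTailOfTwoSided
open Summit.QuantumFields.YangMills.Theorems.LargeFieldMassRefinementTailOfFirstExit

namespace Summit.QuantumFields.YangMills.Theorems

/-- **THE GLUE `HistoryTailOfFirstExit` OF ROUTE `FirstExitWindow` (support item stmt-QuantumFields-26245), PROVED**:
`OneStepWindowL → FirstExitWindowTailL →` the body of the parent crux `UnitScaleTilt.HistoryTailL` — for every block size `L` and floor
`(b₁, p₁)` the profile `(b₀, p₀) = (max b₁ 1, max p₁ 3)` is such that for every `m ≥ 1` the threshold `γ₁ = min γ_W γ_F` (window at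
`(L, b₀, p₀)`, first-exit tail at `(L, b₀, p₀, b₂)`) makes `HistoryTailAt F γ b₀ p₀ m` hold for every family of block size `L` and every
`0 < γ ≤ γ₁`.  Proof: the least-bad-height decomposition, the landed bare tail `T3BareTailProfile.bareTailAt`, the finest-bad-level profile
`exists_finestBad_profile` (window + first-exit tail + per-height arithmetic), and the reduction `historyTailAt_of_bare_finestBad`.  Nothing
here proves the window, the first-exit tail, the rung R3, or anything about the mass gap. [cite: Balaban1985UV3, (7) p.257 and (71) p.273] -/
theorem firstExitWindow_historyTailOfFirstExit_proof :
    Summit.QuantumFields.YangMills.Theses.FirstExitWindow.HistoryTailOfFirstExit := by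
  intro hW hF L b₁ p₁
  obtain ⟨b₀, hb₁, hb₀1⟩ : ∃ b₀ : ℝ, b₁ ≤ b₀ ∧ 1 ≤ b₀ := ⟨max b₁ 1, le_max_left _ _, le_max_right _ _⟩
  obtain ⟨p₀, hp₁, hp₀⟩ : ∃ p₀ : ℝ, p₁ ≤ p₀ ∧ 2 < p₀ :=
    ⟨max p₁ 3, le_max_left _ _, lt_of_lt_of_le (by norm_num) (le_max_right _ _)⟩
  have hb₀ : 0 < b₀ := one_pos.trans_le hb₀1
  have hp₀1 : 1 ≤ p₀ := by linarith
  obtain ⟨b₂, γW, hb₂, hγW, hγW1, hWF⟩ := hW L b₀ p₀ hb₀ hp₀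
  obtain ⟨γF, C, c, N, hγF, -, hc, hFF⟩ := hF L b₀ p₀ b₂ hb₀ hp₀ hb₂
  refine ⟨b₀, p₀, hb₁, hp₁, hb₀, hp₀, fun m hm => ⟨min γW γF, lt_min hγW hγF, fun F γ hFL hγ hle => ?_⟩⟩
  have hγ1 : γ ≤ 1 := hle.trans ((min_le_left _ _).trans hγW1)
  -- the bare profile (landed: reflection positivity + chessboard) and the finest-bad-level profile (window + first-exit tail)
  obtain ⟨q₀, hq₀0, hq₀, -, hbare⟩ := bareTailAt F hγ hγ1 hb₀ hp₀1
  obtain ⟨A', hA'0, hfb⟩ := exists_finestBad_profile F hγ hγ1 hb₀ hp₀1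
    (hWF F γ hFL hγ (hle.trans (min_le_left _ _))) hc (hFF F γ hFL hγ (hle.trans (min_le_right _ _)))
  obtain ⟨hq0, hq, hqt⟩ := geometric_profile hA'0
  exact historyTailAt_of_bare_finestBad F hγ.le b₀ p₀ hm q₀ (fun i => A' * ((1 : ℝ) / 2) ^ i)
    hq₀0 hq₀ hq0 hq hqt hbare fun K j hj1 hjK => hfb K j hj1 (by omega)

end Summit.QuantumFields.YangMills.Theorems

end
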